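import Summits.Ventures.CertifiedManyBodySolver.Certificates.HubbardSquare_n7o8_boxword_cuprate_v3
import HarnessLib

/-!
# Ventures/CertifiedManyBodySolver — Certificates/HubbardSquare_cellword_Kit.lean (hubbard-box-eng-2 g2, cell hubbard-fast)

HONEST FRAMING: transport bookkeeping of certified ground-state-energy bounds; not a superconductivity verdict; not a
pairing bound; no number is certified in this file — it holds the GENERIC composition lemmas used by the census-CELL
kernel words (`HubbardSquare_cellword_*.lean`): a cell is `U ∈ [Uₐ, U_b]` (inside a census rectangle, or the U-shadow of the
last census column), `t′ ∈ [sₐ, s_b]` (between census columns) and a FILLING SLAB `n ∈ [n₁, n₂]` around an anchor density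
`n₀` (the census densities 7/8, 4/5, …). Every lemma is a one-line consequence of the tree's concavity / convexity /
monotonicity theorems for `energyDensityTT'`:
* `cell_node_floor` — a node's floor `L` at `n₀` and a cap `R` at a higher density `n₃` give a floor on the whole slab
  (`energyDensityTT'_ge_min_of_mem_Icc_left/right`: the two extended secants; the vacuum `e(·,0) ≤ 0` is the left anchor);
* `cell_rect_lower_min` — four slab-uniform corner floors give a slab-uniform floor on the closed rectangle (`energyDensityTT'_box_ge_min`);
* `cell_shadow_lower` — the floors of ONE column hold on its whole U-shadow `U ≥ U₁` (`energyDensityTT'_mono_U`);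
* `cell_slab_cap`, `cell_slab_cap_below`, `cell_slab_cap_above` — a face cap `S` at `n₀` and a cap `R` at `n₃ > n₂` give a
  slab cap (`energyDensityTT'_le_vacuum_chord`, `energyDensityTT'_le_density_chord`, `energyDensityTT'_le_max_of_mem_Icc`);
* `cell_slab_cap_even` — half-filling evenness: a cap `C` at `(U', 0, 1)` caps `e(U, t′, n) ≤ max(n₁C, n₂C)` on every slab
  inside `(0,1)` for every `U ≤ U'` and every `t′` (`box3d_halfFilling_cap_of_tp0` + the vacuum chord);
* `cell_cap_U11_n1_of` — the registry-derived half-filling cap at `U = 11` (CERTIFIED #470 ∧ #412, concavity extrapolation).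
-/

noncomputable section

namespace Summit.Ventures.CertifiedManyBodySolver.Certificates

open Matrix Finset Filter Topology
open Literature.MathematicalPhysics.QuantumLattice
open Literature.MathematicalPhysics.QuantumLattice.ThermodynamicLimit
open Literature.Probability.LatticeModels
open scoped ComplexOrder ComplexConjugate Topology BigOperators

/-- **Slab floor at a node.** From a floor `L ≤ e(t′,U,n₀)` at the anchor density `0 < n₀`, a cap `e(t′,U,n₃) ≤ R` at a
higher density `n₃ < 2`, and the vacuum `e(t′,U,0) ≤ 0`: for every `n ∈ [n₁, n₂]` (`0 ≤ n₁`, `n₂ < 2`; the slab may lie on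
either side of `n₀`), `min (min L (L + (L − 0)(n₂ − n₀)/(n₀ − 0))) (min L (L + (L − R)(n₀ − n₁)/(n₃ − n₀))) ≤ e(t′,U,n)`.
[cite: Ruelle1969, §3.3] -/
theorem cell_node_floor {t' U L R n₀ n₁ n₂ n₃ : ℝ} (hU : 0 ≤ U) (hn₀ : 0 < n₀) (hn₁ : 0 ≤ n₁)
    (h₀₃ : n₀ < n₃) (hn₃ : n₃ < 2) (hn₂ : n₂ < 2)
    (hL : L ≤ energyDensityTT' 1 t' U n₀) (hR : energyDensityTT' 1 t' U n₃ ≤ R)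
    {n : ℝ} (hn : n ∈ Set.Icc n₁ n₂) :
    min (min L (L + (L - 0) * (n₂ - n₀) / (n₀ - 0))) (min L (L + (L - R) * (n₀ - n₁) / (n₃ - n₀))) ≤
      energyDensityTT' 1 t' U n := by
  rcases le_total n n₀ with h | h
  · have hn' : n ∈ Set.Icc n₁ n₀ := ⟨hn.1, h⟩
    exact (min_le_right _ _).trans (energyDensityTT'_ge_min_of_mem_Icc_left 1 t' hU (n₁ := n₁) (n₂ := n₀)
      (n₃ := n₃) hn₁ h₀₃ hn₃ hL hR hn')
  · have hn' : n ∈ Set.Icc n₀ n₂ := ⟨h, hn.2⟩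
    exact (min_le_left _ _).trans (energyDensityTT'_ge_min_of_mem_Icc_right 1 t' hU (n₀ := 0) (n₁ := n₀)
      (n₂ := n₂) le_rfl hn₀ hn₂ (energyDensityTT'_density_zero_le 1 t' hU) hL hn')

/-- **Slab-uniform floor on a closed rectangle** `[s₁,s₂] × [U₁,U₂]` of the `(t′,U)` half-plane from slab-uniform floors at
its four corners: the minimum of the four (`energyDensityTT'_box_ge_min` at each density of the slab). [cite: Israel1979, Thm. I.3.4] -/
theorem cell_rect_lower_min {s₁ s₂ U₁ U₂ L₁₁ L₁₂ L₂₁ L₂₂ n₁ n₂ : ℝ} (hU₁ : 0 ≤ U₁) (hs : s₁ < s₂) (hU : U₁ < U₂)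
    (hn₁ : 0 ≤ n₁) (hn₂ : n₂ < 2)
    (h₁₁ : ∀ n ∈ Set.Icc n₁ n₂, L₁₁ ≤ energyDensityTT' 1 s₁ U₁ n)
    (h₁₂ : ∀ n ∈ Set.Icc n₁ n₂, L₁₂ ≤ energyDensityTT' 1 s₁ U₂ n)
    (h₂₁ : ∀ n ∈ Set.Icc n₁ n₂, L₂₁ ≤ energyDensityTT' 1 s₂ U₁ n)
    (h₂₂ : ∀ n ∈ Set.Icc n₁ n₂, L₂₂ ≤ energyDensityTT' 1 s₂ U₂ n)
    {s U n : ℝ} (hs₁ : s₁ ≤ s) (hs₂ : s ≤ s₂) (hU₁' : U₁ ≤ U) (hU₂ : U ≤ U₂)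
    (hn : n ∈ Set.Icc n₁ n₂) :
    min (min L₁₁ L₁₂) (min L₂₁ L₂₂) ≤ energyDensityTT' 1 s U n :=
  energyDensityTT'_box_ge_min 1 (n := n) (by linarith [hn.1]) (by linarith [hn.2]) hU₁ hs hU hs₁ hs₂ hU₁' hU₂
    (h₁₁ n hn) (h₁₂ n hn) (h₂₁ n hn) (h₂₂ n hn)

/-- **Slab-uniform bilinear floor on a closed rectangle** (`energyDensityTT'_box_ge` at each density of the slab) — the
form used when the cell is a proper sub-rectangle of the census rectangle. [cite: Israel1979, Thm. I.3.4] -/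
theorem cell_rect_lower {s₁ s₂ U₁ U₂ L₁₁ L₁₂ L₂₁ L₂₂ n₁ n₂ : ℝ} (hU₁ : 0 ≤ U₁) (hs : s₁ < s₂) (hU : U₁ < U₂)
    (hn₁ : 0 ≤ n₁) (hn₂ : n₂ < 2)
    (h₁₁ : ∀ n ∈ Set.Icc n₁ n₂, L₁₁ ≤ energyDensityTT' 1 s₁ U₁ n)
    (h₁₂ : ∀ n ∈ Set.Icc n₁ n₂, L₁₂ ≤ energyDensityTT' 1 s₁ U₂ n)
    (h₂₁ : ∀ n ∈ Set.Icc n₁ n₂, L₂₁ ≤ energyDensityTT' 1 s₂ U₁ n)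
    (h₂₂ : ∀ n ∈ Set.Icc n₁ n₂, L₂₂ ≤ energyDensityTT' 1 s₂ U₂ n)
    {s U n : ℝ} (hs₁ : s₁ ≤ s) (hs₂ : s ≤ s₂) (hU₁' : U₁ ≤ U) (hU₂ : U ≤ U₂)
    (hn : n ∈ Set.Icc n₁ n₂) :
    ((s₂ - s) * ((U₂ - U) * L₁₁ + (U - U₁) * L₁₂) + (s - s₁) * ((U₂ - U) * L₂₁ + (U - U₁) * L₂₂)) /
        ((s₂ - s₁) * (U₂ - U₁)) ≤ energyDensityTT' 1 s U n :=
  energyDensityTT'_box_ge 1 (n := n) (by linarith [hn.1]) (by linarith [hn.2]) hU₁ hs hU hs₁ hs₂ hU₁' hU₂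
    (h₁₁ n hn) (h₁₂ n hn) (h₂₁ n hn) (h₂₂ n hn)

/-- **U-shadow floor.** Slab-uniform floors at the two nodes `(s₁,U₁)`, `(s₂,U₁)` of ONE column give
`min L₁ L₂ ≤ e(s,U,n)` for every `s ∈ [s₁,s₂]`, every `U ≥ U₁` and every `n` of the slab: concavity in `t′` on the
column (`energyDensityTT'_box_ge_min` on `[U₁, U₁+1]` with the corner floors carried by monotonicity) and then
`energyDensityTT'_mono_U`. [cite: Israel1979, Thm. I.3.4] -/
theorem cell_shadow_lower {s₁ s₂ U₁ L₁ L₂ n₁ n₂ : ℝ} (hU₁ : 0 ≤ U₁) (hs : s₁ < s₂) (hn₁ : 0 ≤ n₁) (hn₂ : n₂ < 2)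
    (h₁ : ∀ n ∈ Set.Icc n₁ n₂, L₁ ≤ energyDensityTT' 1 s₁ U₁ n)
    (h₂ : ∀ n ∈ Set.Icc n₁ n₂, L₂ ≤ energyDensityTT' 1 s₂ U₁ n)
    {s U n : ℝ} (hs₁ : s₁ ≤ s) (hs₂ : s ≤ s₂) (hU : U₁ ≤ U) (hn : n ∈ Set.Icc n₁ n₂) :
    min L₁ L₂ ≤ energyDensityTT' 1 s U n := by
  have hn0 : 0 ≤ n := by linarith [hn.1]
  have hn2 : n < 2 := by linarith [hn.2]
  have m₁ : L₁ ≤ energyDensityTT' 1 s₁ (U₁ + 1) n :=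
    (h₁ n hn).trans (energyDensityTT'_mono_U 1 s₁ hn0 hn2 hU₁ (by linarith))
  have m₂ : L₂ ≤ energyDensityTT' 1 s₂ (U₁ + 1) n :=
    (h₂ n hn).trans (energyDensityTT'_mono_U 1 s₂ hn0 hn2 hU₁ (by linarith))
  have key := energyDensityTT'_box_ge_min 1 (n := n) hn0 hn2 (s := s) (U := U₁) hU₁ hs (by linarith) hs₁ hs₂
    le_rfl (by linarith) (h₁ n hn) m₁ (h₂ n hn) m₂
  have hmono : energyDensityTT' 1 s U₁ n ≤ energyDensityTT' 1 s U n := energyDensityTT'_mono_U 1 s hn0 hn2 hU₁ hU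
  have e : min (min L₁ L₁) (min L₂ L₂) = min L₁ L₂ := by simp
  rw [e] at key
  exact key.trans hmono

/-- **Slab cap across the anchor density.** A cap `e(t′,U,n₀) ≤ S` and a cap `e(t′,U,n₃) ≤ R` at `n₃ > n₂` give, for
`n ∈ [n₁,n₂]` with `0 < n₁ < n₀ < n₂ < n₃ < 2`:
`e(t′,U,n) ≤ max (max S ((n₁/n₀)·S)) (((n₃ − n₂)S + (n₂ − n₀)R)/(n₃ − n₀))` (vacuum chord below `n₀`, density chord above,
convexity in between). [cite: Ruelle1969, §3.3] -/
theorem cell_slab_cap {t' U S R n₀ n₁ n₂ n₃ : ℝ} (hU : 0 ≤ U) (hn₁ : 0 < n₁) (h₁₀ : n₁ < n₀) (h₀₂ : n₀ < n₂)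
    (h₂₃ : n₂ < n₃) (hn₃ : n₃ < 2)
    (hS : energyDensityTT' 1 t' U n₀ ≤ S) (hR : energyDensityTT' 1 t' U n₃ ≤ R)
    {n : ℝ} (hn : n ∈ Set.Icc n₁ n₂) :
    energyDensityTT' 1 t' U n ≤ max (max S (n₁ / n₀ * S)) (((n₃ - n₂) * S + (n₂ - n₀) * R) / (n₃ - n₀)) := by
  have hv := energyDensityTT'_le_vacuum_chord 1 t' hU (n := n₁) (n₂ := n₀) hn₁ h₁₀ (by linarith) hS
  have hc := energyDensityTT'_le_density_chord 1 t' hU (n₁ := n₀) (n := n₂) (n₂ := n₃) (by linarith) h₀₂ h₂₃ hn₃ hS hR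
  rcases le_total n n₀ with h | h
  · have hmax := energyDensityTT'_le_max_of_mem_Icc 1 t' hU (m₁ := n₁) (m₂ := n₀) hn₁.le (by linarith)
      hv hS ⟨hn.1, h⟩
    exact hmax.trans (max_le (le_max_of_le_left (le_max_right _ _)) (le_max_of_le_left (le_max_left _ _)))
  · have hmax := energyDensityTT'_le_max_of_mem_Icc 1 t' hU (m₁ := n₀) (m₂ := n₂) (by linarith) (by linarith)
      hS hc ⟨h, hn.2⟩
    exact hmax.trans (max_le (le_max_of_le_left (le_max_left _ _)) (le_max_right _ _))

/-- **Slab cap below the anchor density** (`0 < n₁`, `n₂ ≤ n₀ < 2`): `e(t′,U,n) ≤ max S ((n₁/n₀)·S)` on `[n₁,n₂]` from a cap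
`S` at `n₀` (vacuum chord + convexity). [cite: Ruelle1969, §3.3] -/
theorem cell_slab_cap_below {t' U S n₀ n₁ n₂ : ℝ} (hU : 0 ≤ U) (hn₁ : 0 < n₁) (h₁₀ : n₁ < n₀) (h₂₀ : n₂ ≤ n₀)
    (hn₀ : n₀ < 2) (hS : energyDensityTT' 1 t' U n₀ ≤ S)
    {n : ℝ} (hn : n ∈ Set.Icc n₁ n₂) :
    energyDensityTT' 1 t' U n ≤ max S (n₁ / n₀ * S) := by
  have hv := energyDensityTT'_le_vacuum_chord 1 t' hU (n := n₁) (n₂ := n₀) hn₁ h₁₀ hn₀ hS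
  have hmax := energyDensityTT'_le_max_of_mem_Icc 1 t' hU (m₁ := n₁) (m₂ := n₀) hn₁.le hn₀ hv hS
    ⟨hn.1, hn.2.trans h₂₀⟩
  exact hmax.trans (max_le (le_max_right _ _) (le_max_left _ _))

/-- **Slab cap above the anchor density** (`0 ≤ n₀ < n₁ ≤ n₂ < n₃ < 2`): with `χ(m) = ((n₃ − m)S + (m − n₀)R)/(n₃ − n₀)`
the density chord of the caps `S` at `n₀` and `R` at `n₃`, `e(t′,U,n) ≤ max χ(n₁) χ(n₂)` on `[n₁,n₂]`. [cite: Ruelle1969, §3.3] -/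
theorem cell_slab_cap_above {t' U S R n₀ n₁ n₂ n₃ : ℝ} (hU : 0 ≤ U) (hn₀ : 0 ≤ n₀) (h₀₁ : n₀ < n₁) (h₁₂ : n₁ ≤ n₂)
    (h₂₃ : n₂ < n₃) (hn₃ : n₃ < 2)
    (hS : energyDensityTT' 1 t' U n₀ ≤ S) (hR : energyDensityTT' 1 t' U n₃ ≤ R)
    {n : ℝ} (hn : n ∈ Set.Icc n₁ n₂) :
    energyDensityTT' 1 t' U n ≤
      max (((n₃ - n₁) * S + (n₁ - n₀) * R) / (n₃ - n₀)) (((n₃ - n₂) * S + (n₂ - n₀) * R) / (n₃ - n₀)) := by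
  have hc₁ := energyDensityTT'_le_density_chord 1 t' hU (n₁ := n₀) (n := n₁) (n₂ := n₃) hn₀ h₀₁ (by linarith) hn₃ hS hR
  have hc₂ := energyDensityTT'_le_density_chord 1 t' hU (n₁ := n₀) (n := n₂) (n₂ := n₃) hn₀ (by linarith) h₂₃ hn₃ hS hR
  exact energyDensityTT'_le_max_of_mem_Icc 1 t' hU (m₁ := n₁) (m₂ := n₂) (by linarith) (by linarith) hc₁ hc₂ hn

/-- **Half-filling evenness cap on a slab.** A cap `e(U',0,1) ≤ C` at half filling gives, for every `0 ≤ U ≤ U'`, every `t′`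
and every `n ∈ [n₁,n₂] ⊂ (0,1)`: `e(U,t′,n) ≤ max (n₁·C) (n₂·C)` (`energyDensityTT'_mono_U`, evenness + concavity at half
filling `box3d_halfFilling_cap_of_tp0`, the vacuum chord, convexity in `n`). [cite: Israel1979, Thm. I.3.4] -/
theorem cell_slab_cap_even {U U' C n₁ n₂ : ℝ} (hU : 0 ≤ U) (hUU' : U ≤ U') (hC : energyDensityTT' 1 0 U' 1 ≤ C)
    (hn₁ : 0 < n₁) (h₁₂ : n₁ ≤ n₂) (hn₂ : n₂ < 1) (t' : ℝ)
    {n : ℝ} (hn : n ∈ Set.Icc n₁ n₂) :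
    energyDensityTT' 1 t' U n ≤ max (n₁ * C) (n₂ * C) := by
  have hm : energyDensityTT' 1 0 U 1 ≤ energyDensityTT' 1 0 U' 1 :=
    energyDensityTT'_mono_U 1 0 (n := 1) (by norm_num) (by norm_num) hU hUU'
  have h1 : energyDensityTT' 1 t' U 1 ≤ C := box3d_halfFilling_cap_of_tp0 hU (hm.trans hC) t'
  have hv₁ := energyDensityTT'_le_vacuum_chord 1 t' hU (n := n₁) (n₂ := 1) hn₁ (by linarith) (by norm_num) h1
  have hv₂ := energyDensityTT'_le_vacuum_chord 1 t' hU (n := n₂) (n₂ := 1) (by linarith) hn₂ (by norm_num) h1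
  have hmax := energyDensityTT'_le_max_of_mem_Icc 1 t' hU (m₁ := n₁) (m₂ := n₂) hn₁.le (by linarith) hv₁ hv₂ hn
  simpa [div_one] using hmax

/-- **Cap at `(11, 0, 1)`** from CERTIFIED #470 (upper at `(12,0,1)`, `−6372417995269/2⁴⁴`) and CERTIFIED #412 (lower at
`(16,0,1)`, `−1461250934424938934288585/2⁸²`) by concavity extrapolation along `U` (`θ = 1/4`):
`e₀(11,0,1) ≤ #470 + (#470 − #412)/4 ≤ −0.3772426288` (outward). [cite: Israel1979, Thm. I.3.4] -/
theorem cell_cap_U11_n1_of (h470 : energyDensityTT' 1 0 12 1 ≤ (((-6372417995269/17592186044416 : ℚ)) : ℝ))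
    (h412 : (((-1461250934424938934288585/4835703278458516698824704 : ℚ)) : ℝ) ≤ energyDensityTT' 1 0 16 1) :
    energyDensityTT' 1 0 11 1 ≤ (((-3772426288/10000000000 : ℚ)) : ℝ) := by
  have h := energyDensityTT'_le_extrapolate_line 1 (n := 1) (by norm_num) (by norm_num) (s₁ := 0) (U₁ := 16)
    (s₂ := 0) (U₂ := 12) (θ := 1/4) (by norm_num) (by norm_num) (by norm_num) h412 h470
  have e1 : (0 : ℝ) + 1/4 * (0 - 0) = 0 := by norm_num
  have e2 : (12 : ℝ) + 1/4 * (12 - 16) = 11 := by norm_num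
  rw [e1, e2] at h
  refine h.trans ?_
  push_cast
  norm_num

end Summit.Ventures.CertifiedManyBodySolver.Certificates

end
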